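import Literature.Analysis.FluidPDE.KatoLaiNestedGalerkin
import Literature.Analysis.FunctionSpaces.DiagonalWeakLimits
import Mathlib.Analysis.Normed.Operator.BanachSteinhaus
import Mathlib.Analysis.Normed.Module.DoubleDual
import Mathlib.Analysis.Calculus.MeanValue
import Mathlib.Analysis.ODE.PicardLindelof
import Mathlib.Topology.UniformSpace.UniformApproximation
import HarnessLib

/-!
# Kato–Lai 1984, Theorem A — Step 2 of the proof and the discharge `KatoLai1984_thmA_holds`

Topic `Literature/Analysis/FluidPDE`. Source: T. Kato, C. Y. Lai, *Nonlinear evolution equations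
and the Euler flow*, J. Funct. Anal. **56** (1984) 15–28, §8, Step 2 (pp. 26–27). This file
completes the proof of the named fact `Literature.Analysis.FluidPDE.KatoLai1984_thmA`
(`KatoLaiAbstractEvolution.lean`) from the Galerkin step `KatoLai.galerkin_exists`
(`KatoLaiGalerkin.lean`) and the weak-continuity lemma `KatoLai.IsSeqWeaklyContinuousOn.continuousOn_comp`
(`KatoLaiNestedGalerkin.lean`), following the printed Step 2:

* `M₁ ⊂ M₂ ⊂ ⋯` finite-dimensional subspaces of `V` with dense union (spans of initial segments
  of a dense sequence of the separable space `V`, `H`-orthonormalised: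
  `KatoLai.exists_orthonormal_family`), Galerkin solutions `u_j` on `I_T` with
  `‖u_j(t)‖² ≤ p(t) ≤ K²` (8.6);
* "since `A` is weakly continuous on `I_{T₀} × H` to `X`, it is bounded (maps bounded sets into
  bounded sets)" — `KatoLai.IsSeqWeaklyContinuousOn.exists_norm_bound`, from weak sequential
  compactness of balls of the separable Hilbert space `H` (`KatoLai.exists_weakLimit_subseq`) and
  the uniform boundedness principle (`KatoLai.exists_bound_of_weakly_convergent`);
* hence `(v | u_j(t))` is equicontinuous on `I_T` for `v ∈ ∪ M_k` ((8.7)), a diagonal weak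
  extraction on a countable dense set of times converges for all `t ∈ I_T`, the weak limit `u(t)`
  exists with `‖u(t)‖² ≤ p(t)` and is weakly continuous, `u(0) = w-lim P_jφ = φ`;
* the weak continuity of `A` and dominated convergence give
  `(v, u(t)) − (v, φ) = −∫₀ᵗ ⟨v, A(s, u(s))⟩ ds` for `v ∈ ∪ M_k`, "this extends as above to all
  `v ∈ V` and proves that `u` is a solution of (A)" (density of `∪ M_k` in `V`, boundedness of
  `A(s, u(s))`, and the fundamental theorem of calculus).

Everything is proved; the file ends with `KatoLai1984_thmA_holds : KatoLai1984_thmA`. As in the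
Galerkin step, neither the monotonicity nor the sign of `β` is used: the strict-supersolution
form of (3.4)–(3.5) absorbs them.

Mathlib/tree search: weak sequential compactness and "weakly convergent ⇒ bounded" are not in
Mathlib as such (`lean search 'weakly convergent|WeakSpace.*bounded|banach_steinhaus'`: only the
uniform boundedness principle `banach_steinhaus` and the bidual isometry
`NormedSpace.inclusionInDoubleDualLi`, which we combine); the diagonal/weak-limit tools are the
tree's `Literature.Analysis.FunctionSpaces.DiagonalWeakLimits`; also used: `stdOrthonormalBasis`,
`Submodule.equivMapOfInjective`, `Convex.norm_image_sub_le_of_norm_hasDerivWithin_le`,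
`intervalIntegral.tendsto_integral_filter_of_dominated_convergence`,
`intervalIntegral.integral_eq_sub_of_hasDeriv_right_of_le`, `ODE.hasDerivWithinAt_picard_Icc`
(FTC within `Icc`), `TendstoUniformlyOn.continuousOn`, `Filter.tendsto_iff_seq_tendsto`.

## References

* T. Kato, C. Y. Lai, J. Funct. Anal. 56 (1984), §8 Step 2, pp. 26–27. [cite: KatoLai1984, §8 Step 2 (pp. 26–27)]
-/

noncomputable section

open Set Filter Topology Metric Function MeasureTheory intervalIntegral
open scoped RealInnerProductSpace

namespace Literature.Analysis.FluidPDE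

namespace KatoLai

universe u v w

/-! ### Weak convergence tools -/

section WeakTools

variable {H : Type v} {X : Type w} [NormedAddCommGroup H] [InnerProductSpace ℝ H]
  [NormedAddCommGroup X] [NormedSpace ℝ X]

/-- **Weakly convergent sequences are bounded** (uniform boundedness principle applied to the
sequence seen in the bidual, which is isometric by Hahn–Banach): if `ℓ(xₙ)` converges for every
`ℓ ∈ X*` then `sup ‖xₙ‖ < ∞`. Used in Kato–Lai's Step 2 in the form "`A` … is bounded". [folklore] -/
theorem exists_bound_of_weakly_convergent {x : ℕ → X}
    (h : ∀ ℓ : StrongDual ℝ X, ∃ l : ℝ, Tendsto (fun n => ℓ (x n)) atTop (𝓝 l)) :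
    ∃ C : ℝ, ∀ n, ‖x n‖ ≤ C := by
  set g : ℕ → StrongDual ℝ (StrongDual ℝ X) :=
    fun n => NormedSpace.inclusionInDoubleDual ℝ X (x n) with hg
  have hpt : ∀ ℓ : StrongDual ℝ X, ∃ C, ∀ n, ‖g n ℓ‖ ≤ C := by
    intro ℓ
    obtain ⟨l, hl⟩ := h ℓ
    obtain ⟨C, hC⟩ := hl.norm.bddAbove_range
    exact ⟨C, fun n => hC ⟨n, rfl⟩⟩
  obtain ⟨C, hC⟩ := banach_steinhaus hpt
  refine ⟨C, fun n => ?_⟩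
  have : ‖g n‖ = ‖x n‖ := (NormedSpace.inclusionInDoubleDualLi (𝕜 := ℝ) (E := X)).norm_map (x n)
  rw [← this]
  exact hC n

/-- **Weak sequential compactness of balls in a separable Hilbert space**: a bounded sequence
`‖wₙ‖ ≤ R` has a subsequence converging weakly to some `w` with `‖w‖ ≤ R` (diagonal extraction of
the pairings with a dense sequence, `Literature.Analysis.FunctionSpaces.exists_strictMono_forall_tendsto_real`,
then `Literature.Analysis.FunctionSpaces.exists_mem_tendsto_inner_of_subset_closure_span`). [folklore] -/
theorem exists_weakLimit_subseq [CompleteSpace H] [TopologicalSpace.SeparableSpace H]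
    {w : ℕ → H} {R : ℝ} (hw : ∀ n, ‖w n‖ ≤ R) :
    ∃ ψ : ℕ → ℕ, StrictMono ψ ∧ ∃ w' : H, ‖w'‖ ≤ R ∧
      ∀ z : H, Tendsto (fun n => ⟪w (ψ n), z⟫) atTop (𝓝 ⟪w', z⟫) := by
  obtain ⟨d, hd⟩ := TopologicalSpace.exists_dense_seq H
  obtain ⟨ψ, hψ, hlim⟩ := FunctionSpaces.exists_strictMono_forall_tendsto_real
    (fun n k => ⟪w n, d k⟫) fun k => ⟨R * ‖d k‖, fun n =>
      (abs_real_inner_le_norm _ _).trans (mul_le_mul_of_nonneg_right (hw n) (norm_nonneg _))⟩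
  have hD : ((⊤ : Submodule ℝ H) : Set H) ⊆ closure (Submodule.span ℝ (Set.range d) : Set H) := by
    intro z _
    have h1 : closure (Set.range d) ⊆ closure (Submodule.span ℝ (Set.range d) : Set H) :=
      closure_mono Submodule.subset_span
    exact h1 (hd.closure_range.symm ▸ mem_univ z)
  obtain ⟨w', -, hw', hconv⟩ := FunctionSpaces.exists_mem_tendsto_inner_of_subset_closure_span
    (⊤ : Submodule ℝ H) isClosed_univ hD (v := fun n => w (ψ n)) (fun _ => Submodule.mem_top)
    (fun n => hw (ψ n)) (by rintro _ ⟨k, rfl⟩; exact hlim k)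
  exact ⟨ψ, hψ, w', hw', hconv⟩

/-- **"Since `A` is weakly continuous on `I × H` to `X`, it is bounded (maps bounded sets into
bounded sets)"** (Kato–Lai 1984, p. 27), norm form (the scalar form, one functional at a time,
is `IsSeqWeaklyContinuousOn.exists_bound` of `KatoLaiNestedGalerkin`): a sequentially weakly
continuous `A` is norm-bounded on `[a, b] × {‖w‖ ≤ R}`. Otherwise `‖A(tₙ, wₙ)‖ → ∞` along a sequence which, after extraction,
has `tₙ → t` and `wₙ ⇀ w`, so `A(tₙ, wₙ) ⇀ A(t, w)` is weakly convergent, hence bounded.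
[cite: KatoLai1984, §8 Step 2 (p. 27)] -/
theorem IsSeqWeaklyContinuousOn.exists_norm_bound [CompleteSpace H]
    [TopologicalSpace.SeparableSpace H]
    {A : ℝ → H → X} {a b : ℝ} (hA : IsSeqWeaklyContinuousOn (Icc a b) A) (R : ℝ) :
    ∃ C : ℝ, ∀ t ∈ Icc a b, ∀ w : H, ‖w‖ ≤ R → ‖A t w‖ ≤ C := by
  by_contra hcon
  push Not at hcon
  choose t ht w hwR hlt using fun n : ℕ => hcon n
  -- extract: `t ∘ ψ₁ → t'` in the compact interval, then `w ∘ ψ₁ ∘ ψ₂ ⇀ w'`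
  obtain ⟨t', ht', ψ₁, hψ₁, ht₁⟩ := isCompact_Icc.tendsto_subseq ht
  obtain ⟨ψ₂, hψ₂, w', -, hw'⟩ := exists_weakLimit_subseq (w := fun n => w (ψ₁ n)) fun n => hwR _
  have hψm : StrictMono (fun n => ψ₁ (ψ₂ n)) := hψ₁.comp hψ₂
  have hweak : ∀ ℓ : StrongDual ℝ X,
      Tendsto (fun n => ℓ (A (t (ψ₁ (ψ₂ n))) (w (ψ₁ (ψ₂ n))))) atTop (𝓝 (ℓ (A t' w'))) :=
    hA (fun n => t (ψ₁ (ψ₂ n))) t' (fun n => w (ψ₁ (ψ₂ n))) w' (fun n => ht _) ht'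
      (ht₁.comp hψ₂.tendsto_atTop) (fun h => by simpa only [real_inner_comm] using hw' h)
  obtain ⟨C, hC⟩ := exists_bound_of_weakly_convergent
    (x := fun n => A (t (ψ₁ (ψ₂ n))) (w (ψ₁ (ψ₂ n)))) fun ℓ => ⟨_, hweak ℓ⟩
  -- contradiction with `‖A(t_{ψ n}, w_{ψ n})‖ > ψ n ≥ n`
  obtain ⟨n, hn⟩ := exists_nat_gt C
  have h1 := hlt (ψ₁ (ψ₂ n))
  have h2 : (n : ℝ) ≤ ψ₁ (ψ₂ n) := by exact_mod_cast hψm.id_le n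
  have h3 := hC n
  linarith

end WeakTools

/-! ### `H`-orthonormal bases of finite-dimensional subspaces of `V` -/

section Orthonormalise

variable {V : Type u} {H : Type v} {X : Type w}
  [NormedAddCommGroup V] [NormedSpace ℝ V] [NormedAddCommGroup H] [InnerProductSpace ℝ H]
  [NormedAddCommGroup X] [NormedSpace ℝ X]

/-- **`H`-orthonormal basis of a finite-dimensional `M ⊂ V`** ("If `{e₁, …, e_m}` is an orthonormal
basis of `M ⊂ H`", Kato–Lai 1984, p. 26): for a finite-dimensional subspace `W` of `V` there is a
finite family `e₁, …, e_m ∈ W`, orthonormal in `H`, such that every `v ∈ W` is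
`Σ_i (e_i | v)_H e_i` (pull back an orthonormal basis of the finite-dimensional subspace
`ι(W) ⊂ H` along the injective `ι = inclVH`). [cite: KatoLai1984, §8 Step 1 (p. 26)] -/
theorem exists_orthonormal_family (𝒯 : AdmissibleTriplet V H X) (W : Submodule ℝ V)
    [FiniteDimensional ℝ W] :
    ∃ (m : ℕ) (e : Fin m → V), Orthonormal ℝ (𝒯.inclVH ∘ e) ∧ (∀ i, e i ∈ W) ∧
      ∀ v ∈ W, v = ∑ i, ⟪𝒯.inclVH (e i), 𝒯.inclVH v⟫ • e i := by
  set ι : V →ₗ[ℝ] H := (𝒯.inclVH : V →ₗ[ℝ] H) with hι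
  have hinj : Function.Injective ι := 𝒯.injective_inclVH
  set K : Submodule ℝ H := W.map ι with hK
  set Φ : W ≃ₗ[ℝ] K := Submodule.equivMapOfInjective ι hinj W with hΦ
  haveI : FiniteDimensional ℝ K := LinearEquiv.finiteDimensional Φ
  set b := stdOrthonormalBasis ℝ K with hb
  refine ⟨Module.finrank ℝ K, fun i => ((Φ.symm (b i) : W) : V), ?_, fun i => (Φ.symm (b i)).2, ?_⟩
  · -- orthonormality: `ι (Φ.symm (b i)) = b i` in `H`
    have hcoe : (𝒯.inclVH ∘ fun i => ((Φ.symm (b i) : W) : V)) = fun i => ((b i : K) : H) := by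
      funext i
      simp only [Function.comp_apply]
      have := Submodule.coe_equivMapOfInjective_apply ι hinj W (Φ.symm (b i))
      rw [hΦ, LinearEquiv.apply_symm_apply] at this
      exact this.symm
    rw [hcoe]
    exact (K.subtypeₗᵢ.orthonormal_comp_iff).2 b.orthonormal
  · intro v hv
    -- `ι e_i = b i` and `ι v = Φ ⟨v, hv⟩` in `H`; compare after applying the injective `ι`
    have hιe : ∀ i, 𝒯.inclVH ((Φ.symm (b i) : W) : V) = ((b i : K) : H) := fun i => by
      have h := Submodule.coe_equivMapOfInjective_apply ι hinj W (Φ.symm (b i))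
      rw [hΦ, LinearEquiv.apply_symm_apply] at h
      exact h.symm
    have hιv : 𝒯.inclVH v = ((Φ ⟨v, hv⟩ : K) : H) :=
      (Submodule.coe_equivMapOfInjective_apply ι hinj W ⟨v, hv⟩).symm
    apply 𝒯.injective_inclVH
    rw [map_sum]
    simp_rw [map_smul, hιe, hιv]
    have h := congrArg (fun k : K => (k : H)) (b.sum_repr' (Φ ⟨v, hv⟩))
    simp only [AddSubmonoidClass.coe_finsetSum, Submodule.coe_smul, Submodule.coe_inner] at h
    exact h.symm

/-- **Best approximation by the span of an orthonormal family**: with `Pφ = Σ (f_i | φ) f_i`,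
`‖φ − Pφ‖ ≤ ‖φ − z‖` for every `z` in the span of the `f_i` (`φ − Pφ ⊥ span`, Pythagoras). Used for
`P_jφ → φ` ("`P_j → 1` strongly on `H`", Kato–Lai 1984, p. 26). [folklore] -/
theorem norm_sub_sum_inner_smul_le {m : ℕ} {f : Fin m → H} (hf : Orthonormal ℝ f) (φ : H) {z : H}
    (hz : z ∈ Submodule.span ℝ (Set.range f)) :
    ‖φ - ∑ i, ⟪f i, φ⟫ • f i‖ ≤ ‖φ - z‖ := by
  set P : H := ∑ i, ⟪f i, φ⟫ • f i with hP
  have hPmem : P ∈ Submodule.span ℝ (Set.range f) :=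
    Submodule.sum_mem _ fun i _ => Submodule.smul_mem _ _ (Submodule.subset_span ⟨i, rfl⟩)
  -- `φ - P ⊥ span (range f)`
  have horth : ∀ y ∈ Submodule.span ℝ (Set.range f), ⟪φ - P, y⟫ = 0 := by
    intro y hy
    induction hy using Submodule.span_induction with
    | mem y hy =>
      obtain ⟨i, rfl⟩ := hy
      rw [inner_sub_left, hP, hf.inner_left_fintype, real_inner_comm, conj_trivial, sub_self]
    | zero => exact inner_zero_right _
    | add a b _ _ ha hb => rw [inner_add_right, ha, hb, add_zero]
    | smul c a _ ha => rw [real_inner_smul_right, ha, mul_zero]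
  have hdecomp : φ - z = (φ - P) + (P - z) := by abel
  have hpyth : ‖φ - z‖ * ‖φ - z‖ = ‖φ - P‖ * ‖φ - P‖ + ‖P - z‖ * ‖P - z‖ := by
    rw [hdecomp]
    exact norm_add_sq_eq_norm_sq_add_norm_sq_real
      (horth _ (Submodule.sub_mem _ hPmem hz))
  nlinarith [norm_nonneg (φ - z), norm_nonneg (φ - P), norm_nonneg (P - z)]

end Orthonormalise

end KatoLai

/-! ### Proof of Theorem A -/

open KatoLai in
/-- **Kato–Lai 1984, Theorem A — discharge of the named fact `KatoLai1984_thmA`** (§3 p. 18;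
proof §8 pp. 25–27: Galerkin approximation `KatoLai.galerkin_exists`, boundedness of the weakly
continuous `A` on bounded sets, equicontinuity and diagonal weak extraction, weak limit, passage to
the limit by dominated convergence, extension to all `v ∈ V` by density, fundamental theorem of
calculus). [cite: KatoLai1984, §3 Thm A (p. 18); proof §8 (pp. 25–27)] -/
theorem KatoLai1984_thmA_holds : KatoLai1984_thmA := by
  intro V H X _ _ _ _ _ _ _ _ _ _ _ _ 𝒯 T₀ A β hA _ _ hcoer φ T hT hTT₀ p p' hp hp0 hsuper
  have hIcc : Icc 0 T ⊆ Icc 0 T₀ := Icc_subset_Icc le_rfl hTT₀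
  have hAT : IsSeqWeaklyContinuousOn (Icc 0 T) A := hA.mono hIcc
  /- ## finite-dimensional subspaces `W n = span {d 0, …, d n}` of a dense sequence `d` -/
  obtain ⟨d, hd⟩ := TopologicalSpace.exists_dense_seq V
  let W : ℕ → Submodule ℝ V := fun n => Submodule.span ℝ (Set.range fun i : Fin (n + 1) => d i)
  have hdW : ∀ {a n : ℕ}, a ≤ n → d a ∈ W n := fun {a n} h =>
    Submodule.subset_span ⟨⟨a, Nat.lt_succ_of_le h⟩, rfl⟩
  have hfam : ∀ n : ℕ, ∃ (m : ℕ) (e : Fin m → V), Orthonormal ℝ (𝒯.inclVH ∘ e) ∧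
      (∀ i, e i ∈ W n) ∧ ∀ v ∈ W n, v = ∑ i, ⟪𝒯.inclVH (e i), 𝒯.inclVH v⟫ • e i := fun n => by
    haveI : FiniteDimensional ℝ (W n) := FiniteDimensional.span_of_finite ℝ (Set.finite_range _)
    exact exists_orthonormal_family 𝒯 (W n)
  choose m e he heW hexp using hfam
  /- ## Galerkin solutions -/
  have hgal : ∀ n : ℕ, ∃ u : ℝ → H, ContinuousOn u (Icc 0 T) ∧
      u 0 = ∑ i, ⟪𝒯.inclVH (e n i), φ⟫ • 𝒯.inclVH (e n i) ∧
      (∀ t ∈ Icc 0 T, ‖u t‖ ^ 2 ≤ p t) ∧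
      (∀ t, u t ∈ Submodule.span ℝ (Set.range (𝒯.inclVH ∘ e n))) ∧
      ∀ i : Fin (m n), ∀ t ∈ Icc 0 T, HasDerivWithinAt (fun s => ⟪𝒯.inclVH (e n i), u s⟫)
        (-(𝒯.pairing (e n i) (A t (u t)))) (Icc 0 T) t := fun n =>
    galerkin_exists 𝒯 hA hcoer φ hT hTT₀ hp hp0 hsuper (e n) (he n)
  choose u huc hu0 hup husp hud using hgal
  /- ## uniform bounds -/
  have hpnn : ∀ t ∈ Icc 0 T, 0 ≤ p t := fun t ht => (sq_nonneg _).trans (hup 0 t ht)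
  have hpc : ContinuousOn p (Icc 0 T) := fun t ht => (hp t ht).continuousWithinAt
  obtain ⟨P, hP⟩ : ∃ P, ∀ t ∈ Icc 0 T, p t ≤ P := by
    obtain ⟨P, hP⟩ := isCompact_Icc.bddAbove_image hpc
    exact ⟨P, fun t ht => hP (mem_image_of_mem p ht)⟩
  set R : ℝ := Real.sqrt P with hR
  have hR0 : 0 ≤ R := Real.sqrt_nonneg _
  have hsqrt_le : ∀ {y : H} {t : ℝ}, t ∈ Icc 0 T → ‖y‖ ^ 2 ≤ p t → ‖y‖ ≤ Real.sqrt (p t) :=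
    fun {y t} ht h => by
      rw [← Real.sqrt_sq (norm_nonneg y)]
      exact Real.sqrt_le_sqrt h
  have hsqrtP : ∀ {t : ℝ}, t ∈ Icc 0 T → Real.sqrt (p t) ≤ R := fun {t} ht =>
    Real.sqrt_le_sqrt (hP t ht)
  have huR : ∀ n, ∀ t ∈ Icc 0 T, ‖u n t‖ ≤ R := fun n t ht =>
    (hsqrt_le ht (hup n t ht)).trans (hsqrtP ht)
  obtain ⟨C, hC⟩ := hAT.exists_norm_bound R
  have hC0 : 0 ≤ C := (norm_nonneg _).trans (hC 0 ⟨le_rfl, hT.le⟩ 0 (by simp [hR0]))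
  have hAu : ∀ n, ∀ t ∈ Icc 0 T, ‖A t (u n t)‖ ≤ C := fun n t ht => hC t ht _ (huR n t ht)
  /- ## the equation tested against `v ∈ W n`, and the equi-Lipschitz bound -/
  have hdv : ∀ n, ∀ v ∈ W n, ∀ t ∈ Icc 0 T, HasDerivWithinAt (fun s => ⟪𝒯.inclVH v, u n s⟫)
      (-(𝒯.pairing v (A t (u n t)))) (Icc 0 T) t := by
    intro n v hv t ht
    have hv' := hexp n v hv
    have h1 : ∀ s, ⟪𝒯.inclVH v, u n s⟫ =
        ∑ i, ⟪𝒯.inclVH (e n i), 𝒯.inclVH v⟫ * ⟪𝒯.inclVH (e n i), u n s⟫ := fun s => by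
      conv_lhs => rw [hv']
      simp only [map_sum, map_smul, sum_inner, real_inner_smul_left]
    have h2 : -(𝒯.pairing v (A t (u n t))) =
        ∑ i, ⟪𝒯.inclVH (e n i), 𝒯.inclVH v⟫ * -(𝒯.pairing (e n i) (A t (u n t))) := by
      conv_lhs => rw [hv']
      simp [map_sum, map_smul]
    simp_rw [h1]
    rw [h2]
    exact HasDerivWithinAt.fun_sum fun i _ => (hud n i t ht).const_mul _
  have hLip : ∀ n, ∀ v ∈ W n, ∀ s ∈ Icc 0 T, ∀ t ∈ Icc 0 T,
      ‖⟪𝒯.inclVH v, u n t⟫ - ⟪𝒯.inclVH v, u n s⟫‖ ≤ (‖𝒯.pairing‖ * ‖v‖ * C) * ‖t - s‖ := by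
    intro n v hv s hs t ht
    refine Convex.norm_image_sub_le_of_norm_hasDerivWithin_le (fun x hx => hdv n v hv x hx)
      (fun x hx => ?_) (convex_Icc 0 T) hs ht
    rw [norm_neg]
    calc ‖𝒯.pairing v (A x (u n x))‖ ≤ ‖𝒯.pairing v‖ * ‖A x (u n x)‖ :=
          (𝒯.pairing v).le_opNorm _
      _ ≤ (‖𝒯.pairing‖ * ‖v‖) * C :=
          mul_le_mul (𝒯.pairing.le_opNorm v) (hAu n x hx) (norm_nonneg _) (by positivity)
  /- ## diagonal extraction over pairs (index of `d`, rational time) -/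
  let clamp : ℝ → ℝ := fun r => max 0 (min r T)
  have hclampc : Continuous clamp := continuous_const.max (continuous_id.min continuous_const)
  have hclampI : ∀ r, clamp r ∈ Icc 0 T := fun r =>
    ⟨le_max_left _ _, max_le hT.le (min_le_right _ _)⟩
  have hclampid : ∀ t ∈ Icc 0 T, clamp t = t := fun t ht => by
    show max 0 (min t T) = t
    rw [min_eq_left ht.2, max_eq_right ht.1]
  obtain ⟨φ₀, hφ₀, hlim0⟩ := FunctionSpaces.exists_strictMono_forall_tendsto_real
    (fun n (aq : ℕ × ℚ) => ⟪𝒯.inclVH (d aq.1), u n (clamp aq.2)⟫) fun aq =>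
      ⟨‖𝒯.inclVH (d aq.1)‖ * R, fun n => (abs_real_inner_le_norm _ _).trans
        (mul_le_mul_of_nonneg_left (huR n _ (hclampI _)) (norm_nonneg _))⟩
  have hφ₀le : ∀ n, n ≤ φ₀ n := hφ₀.id_le
  /- ## convergence of `(d a | u (φ₀ n) t)` for every `a` and every `t ∈ [0, T]` -/
  set D : Set ℝ := clamp '' Set.range ((↑) : ℚ → ℝ) with hDdef
  have hSD : Icc 0 T ⊆ closure D := fun t ht => by
    have h1 := image_closure_subset_closure_image hclampc (s := Set.range ((↑) : ℚ → ℝ))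
    rw [Rat.denseRange_cast.closure_range, Set.image_univ] at h1
    exact h1 ⟨t, hclampid t ht⟩
  have hDI : D ⊆ Icc 0 T := by rintro _ ⟨r, -, rfl⟩; exact hclampI r
  have hconvW : ∀ a : ℕ, ∀ t ∈ Icc 0 T,
      ∃ l, Tendsto (fun n => ⟪𝒯.inclVH (d a), u (φ₀ n) t⟫) atTop (𝓝 l) := by
    intro a
    have key := FunctionSpaces.forall_exists_tendsto_of_subset_closure
      (x := fun n t => ⟪𝒯.inclVH (d a), u (φ₀ (n + a)) t⟫) (S := Icc 0 T) (D := D) hSD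
      (by
        rintro _ ⟨_, ⟨q, rfl⟩, rfl⟩
        obtain ⟨l, hl⟩ := hlim0 (a, q)
        exact ⟨l, hl.comp (tendsto_add_atTop_nat a)⟩)
      (fun ε hε => by
        refine ⟨ε / (‖𝒯.pairing‖ * ‖d a‖ * C + 1), by positivity, fun n t ht d' hd' htd => ?_⟩
        have hmem : d a ∈ W (φ₀ (n + a)) := hdW ((Nat.le_add_left a n).trans (hφ₀le _))
        rw [Real.dist_eq]
        calc |⟪𝒯.inclVH (d a), u (φ₀ (n + a)) t⟫ - ⟪𝒯.inclVH (d a), u (φ₀ (n + a)) d'⟫|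
            ≤ (‖𝒯.pairing‖ * ‖d a‖ * C) * |t - d'| := by
              have := hLip (φ₀ (n + a)) (d a) hmem d' (hDI hd') t ht
              rwa [Real.norm_eq_abs, Real.norm_eq_abs] at this
          _ ≤ (‖𝒯.pairing‖ * ‖d a‖ * C) * (ε / (‖𝒯.pairing‖ * ‖d a‖ * C + 1)) := by
              rw [← Real.dist_eq]
              exact mul_le_mul_of_nonneg_left htd.le (by positivity)
          _ < ε := by
              rw [mul_div_assoc', div_lt_iff₀ (by positivity)]
              nlinarith [show 0 ≤ ‖𝒯.pairing‖ * ‖d a‖ * C by positivity])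
    intro t ht
    obtain ⟨l, hl⟩ := key t ht
    exact ⟨l, (tendsto_add_atTop_iff_nat a).1 hl⟩
  /- ## the weak limit `U t` -/
  have hdense : Dense (Set.range (𝒯.inclVH ∘ d)) := by
    rw [Set.range_comp]
    exact 𝒯.denseRange_inclVH.dense_image 𝒯.inclVH.continuous hd
  have hDH : ((⊤ : Submodule ℝ H) : Set H) ⊆
      closure (Submodule.span ℝ (Set.range (𝒯.inclVH ∘ d)) : Set H) := fun z _ =>
    closure_mono Submodule.subset_span (hdense.closure_eq.symm ▸ mem_univ z)
  have hweak : ∀ t ∈ Icc 0 T, ∃ w : H, ‖w‖ ≤ Real.sqrt (p t) ∧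
      ∀ z : H, Tendsto (fun n => ⟪u (φ₀ n) t, z⟫) atTop (𝓝 ⟪w, z⟫) := by
    intro t ht
    obtain ⟨w, -, hw, hconv⟩ := FunctionSpaces.exists_mem_tendsto_inner_of_subset_closure_span
      (⊤ : Submodule ℝ H) isClosed_univ hDH (v := fun n => u (φ₀ n) t)
      (fun _ => Submodule.mem_top) (fun n => hsqrt_le ht (hup _ t ht))
      (by
        rintro _ ⟨a, rfl⟩
        obtain ⟨l, hl⟩ := hconvW a t ht
        exact ⟨l, by simpa only [real_inner_comm, Function.comp_apply] using hl⟩)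
    exact ⟨w, hw, hconv⟩
  choose! U hUnorm hUconv using hweak
  have hUR : ∀ t ∈ Icc 0 T, ‖U t‖ ≤ R := fun t ht => (hUnorm t ht).trans (hsqrtP ht)
  have hAU : ∀ t ∈ Icc 0 T, ‖A t (U t)‖ ≤ C := fun t ht => hC t ht _ (hUR t ht)
  have hUconv' : ∀ t ∈ Icc 0 T, ∀ z : H,
      Tendsto (fun n => ⟪z, u (φ₀ n) t⟫) atTop (𝓝 ⟪z, U t⟫) := fun t ht z => by
    simpa only [real_inner_comm] using hUconv t ht z
  /- ## `U 0 = φ`: the Galerkin data `P_n φ` converge strongly to `φ` -/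
  have hu0conv : Tendsto (fun n => u n 0) atTop (𝓝 φ) := by
    rw [Metric.tendsto_atTop]
    intro ε hε
    obtain ⟨_, ⟨a, rfl⟩, ha⟩ := Metric.mem_closure_iff.1 (hdense.closure_eq.symm ▸ mem_univ φ) ε hε
    refine ⟨a, fun n hn => ?_⟩
    rw [dist_comm, dist_eq_norm, hu0 n]
    have hmem : (𝒯.inclVH ∘ d) a ∈ Submodule.span ℝ (Set.range (𝒯.inclVH ∘ e n)) := by
      have h1 := hexp n (d a) (hdW hn)
      rw [Function.comp_apply, h1, map_sum]
      refine Submodule.sum_mem _ fun i _ => ?_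
      rw [map_smul]
      exact Submodule.smul_mem _ _ (Submodule.subset_span ⟨i, rfl⟩)
    calc ‖φ - ∑ i, ⟪𝒯.inclVH (e n i), φ⟫ • 𝒯.inclVH (e n i)‖
        ≤ ‖φ - (𝒯.inclVH ∘ d) a‖ := norm_sub_sum_inner_smul_le (he n) φ hmem
      _ < ε := by rwa [dist_eq_norm] at ha
  have hU0 : U 0 = φ := by
    have h0 : (0 : ℝ) ∈ Icc 0 T := ⟨le_rfl, hT.le⟩
    refine ext_inner_left ℝ fun z => ?_
    have h1 : Tendsto (fun n => ⟪z, u (φ₀ n) 0⟫) atTop (𝓝 ⟪z, φ⟫) :=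
      ((continuous_const.inner continuous_id).tendsto φ).comp (hu0conv.comp hφ₀.tendsto_atTop)
    exact tendsto_nhds_unique (hUconv' 0 h0 z) h1
  /- ## weak continuity of `U` on `[0, T]` -/
  have hUlip : ∀ a : ℕ, ∀ s ∈ Icc 0 T, ∀ t ∈ Icc 0 T,
      dist ⟪𝒯.inclVH (d a), U t⟫ ⟪𝒯.inclVH (d a), U s⟫ ≤ (‖𝒯.pairing‖ * ‖d a‖ * C) * dist t s := by
    intro a s hs t ht
    refine le_of_tendsto ((hUconv' t ht _).dist (hUconv' s hs _)) ?_
    filter_upwards [eventually_ge_atTop a] with n hn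
    rw [Real.dist_eq, Real.dist_eq]
    have := hLip (φ₀ n) (d a) (hdW (hn.trans (hφ₀le n))) s hs t ht
    rwa [Real.norm_eq_abs, Real.norm_eq_abs] at this
  have hUcontd : ∀ a : ℕ, ContinuousOn (fun t => ⟪𝒯.inclVH (d a), U t⟫) (Icc 0 T) := fun a =>
    (LipschitzOnWith.of_dist_le' fun t ht s hs => hUlip a s hs t ht).continuousOn
  have hUweak : ∀ z : H, ContinuousOn (fun t => ⟪z, U t⟫) (Icc 0 T) := by
    intro z
    obtain ⟨y, hy, hyz⟩ := mem_closure_iff_seq_limit.1 (hdense.closure_eq.symm ▸ mem_univ z)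
    choose a ha using fun k => Set.mem_range.1 (hy k)
    have hF : TendstoUniformlyOn (fun k t => ⟪𝒯.inclVH (d (a k)), U t⟫) (fun t => ⟪z, U t⟫) atTop
        (Icc 0 T) := by
      rw [Metric.tendstoUniformlyOn_iff]
      intro ε hε
      have hyz' : Tendsto (fun k => 𝒯.inclVH (d (a k))) atTop (𝓝 z) := by
        convert hyz using 1
        funext k
        exact ha k
      filter_upwards [Metric.tendsto_atTop.1 hyz' (ε / (R + 1)) (by positivity) |> fun ⟨N, hN⟩ =>
        eventually_atTop.2 ⟨N, hN⟩] with k hk t ht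
      rw [Real.dist_eq, ← inner_sub_left]
      calc |⟪z - 𝒯.inclVH (d (a k)), U t⟫| ≤ ‖z - 𝒯.inclVH (d (a k))‖ * ‖U t‖ :=
            abs_real_inner_le_norm _ _
        _ ≤ (ε / (R + 1)) * R := by
            refine mul_le_mul ?_ (hUR t ht) (norm_nonneg _) (by positivity)
            rw [← dist_eq_norm, dist_comm]; exact hk.le
        _ < ε := by
            rw [div_mul_eq_mul_div, div_lt_iff₀ (by positivity)]
            nlinarith
    exact hF.continuousOn (Eventually.of_forall fun k => hUcontd (a k)).frequently
  /- ## continuity of the integrands -/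
  have hgU : ∀ v : V, ContinuousOn (fun s => 𝒯.pairing v (A s (U s))) (Icc 0 T) := fun v =>
    hA.continuousOn_comp hIcc hUweak (𝒯.pairing v)
  have hgu : ∀ n, ∀ v : V, ContinuousOn (fun s => 𝒯.pairing v (A s (u n s))) (Icc 0 T) :=
    fun n v => hA.continuousOn_comp hIcc
      (fun h => ((continuous_const.inner continuous_id).comp_continuousOn (huc n))) (𝒯.pairing v)
  /- ## the integrated equation for `v = d a`, in the limit -/
  have hint_u : ∀ n a, a ≤ n → ∀ t ∈ Icc 0 T,
      ⟪𝒯.inclVH (d a), u n t⟫ - ⟪𝒯.inclVH (d a), u n 0⟫ =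
        ∫ s in (0 : ℝ)..t, -(𝒯.pairing (d a) (A s (u n s))) := by
    intro n a han t ht
    have hsub : Icc 0 t ⊆ Icc 0 T := Icc_subset_Icc le_rfl ht.2
    have hsub' : uIcc 0 t ⊆ Icc 0 T := by rw [uIcc_of_le ht.1]; exact hsub
    have hcontg : ContinuousOn (fun s => -(𝒯.pairing (d a) (A s (u n s)))) (uIcc 0 t) :=
      fun s hs => ((hgu n (d a)) s (hsub' hs)).neg.mono hsub'
    have key := integral_eq_sub_of_hasDeriv_right_of_le (f := fun s => ⟪𝒯.inclVH (d a), u n s⟫)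
      (f' := fun s => -(𝒯.pairing (d a) (A s (u n s)))) ht.1
      (fun s hs => (hdv n (d a) (hdW han) s (hsub hs)).continuousWithinAt.mono hsub)
      (fun s hs => ?_) hcontg.intervalIntegrable
    · exact key.symm
    · have hs' : s ∈ Icc 0 T := hsub (Ioo_subset_Icc_self hs)
      exact ((hdv n (d a) (hdW han) s hs').hasDerivAt
        (Icc_mem_nhds hs.1 (hs.2.trans_le ht.2))).hasDerivWithinAt
  have hident_d : ∀ a, ∀ t ∈ Icc 0 T,
      ⟪𝒯.inclVH (d a), U t⟫ - ⟪𝒯.inclVH (d a), φ⟫ =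
        ∫ s in (0 : ℝ)..t, -(𝒯.pairing (d a) (A s (U s))) := by
    intro a t ht
    have h0 : (0 : ℝ) ∈ Icc 0 T := ⟨le_rfl, hT.le⟩
    -- along the shifted subsequence `N = φ₀ (n + a) ≥ a`
    have hlhs : Tendsto (fun n => ⟪𝒯.inclVH (d a), u (φ₀ (n + a)) t⟫ -
        ⟪𝒯.inclVH (d a), u (φ₀ (n + a)) 0⟫) atTop
        (𝓝 (⟪𝒯.inclVH (d a), U t⟫ - ⟪𝒯.inclVH (d a), φ⟫)) := by
      refine ((hUconv' t ht _).comp (tendsto_add_atTop_nat a)).sub ?_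
      have h1 : Tendsto (fun n => u (φ₀ (n + a)) 0) atTop (𝓝 φ) :=
        hu0conv.comp (hφ₀.tendsto_atTop.comp (tendsto_add_atTop_nat a))
      exact ((continuous_const.inner continuous_id).tendsto φ).comp h1
    have hrhs : Tendsto (fun n => ∫ s in (0 : ℝ)..t, -(𝒯.pairing (d a) (A s (u (φ₀ (n + a)) s))))
        atTop (𝓝 (∫ s in (0 : ℝ)..t, -(𝒯.pairing (d a) (A s (U s))))) := by
      refine intervalIntegral.tendsto_integral_filter_of_dominated_convergence
        (fun _ => ‖𝒯.pairing‖ * ‖d a‖ * C) (Eventually.of_forall fun n => ?_)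
        (Eventually.of_forall fun n => ae_of_all _ fun s hs => ?_) intervalIntegrable_const
        (ae_of_all _ fun s hs => ?_)
      · refine ((hgu _ (d a)).neg.mono ?_).aestronglyMeasurable measurableSet_uIoc
        rw [uIoc_of_le ht.1]
        exact Ioc_subset_Icc_self.trans (Icc_subset_Icc le_rfl ht.2)
      · rw [uIoc_of_le ht.1] at hs
        have hs' : s ∈ Icc 0 T := ⟨hs.1.le, hs.2.trans ht.2⟩
        rw [norm_neg]
        calc ‖𝒯.pairing (d a) (A s (u (φ₀ (n + a)) s))‖
            ≤ ‖𝒯.pairing (d a)‖ * ‖A s (u (φ₀ (n + a)) s)‖ := (𝒯.pairing (d a)).le_opNorm _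
          _ ≤ (‖𝒯.pairing‖ * ‖d a‖) * C :=
            mul_le_mul (𝒯.pairing.le_opNorm _) (hAu _ s hs') (norm_nonneg _) (by positivity)
      · rw [uIoc_of_le ht.1] at hs
        have hs' : s ∈ Icc 0 T := ⟨hs.1.le, hs.2.trans ht.2⟩
        refine (hA (fun _ => s) s (fun n => u (φ₀ (n + a)) s) (U s) (fun _ => hIcc hs') (hIcc hs')
          tendsto_const_nhds (fun h => (hUconv' s hs' h).comp (tendsto_add_atTop_nat a))
          (𝒯.pairing (d a))).neg
    have heq : ∀ n, ⟪𝒯.inclVH (d a), u (φ₀ (n + a)) t⟫ - ⟪𝒯.inclVH (d a), u (φ₀ (n + a)) 0⟫ =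
        ∫ s in (0 : ℝ)..t, -(𝒯.pairing (d a) (A s (u (φ₀ (n + a)) s))) := fun n =>
      hint_u _ a ((Nat.le_add_left a n).trans (hφ₀le _)) t ht
    exact tendsto_nhds_unique (hlhs.congr heq) hrhs
  /- ## extension to all `v ∈ V` by density -/
  have hident : ∀ v : V, ∀ t ∈ Icc 0 T,
      ⟪𝒯.inclVH v, U t⟫ - ⟪𝒯.inclVH v, φ⟫ = ∫ s in (0 : ℝ)..t, -(𝒯.pairing v (A s (U s))) := by
    intro v t ht
    obtain ⟨y, hy, hyv⟩ := mem_closure_iff_seq_limit.1 (hd.closure_range.symm ▸ mem_univ v)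
    choose a ha using fun k => Set.mem_range.1 (hy k)
    have hav : Tendsto (fun k => d (a k)) atTop (𝓝 v) := by
      convert hyv using 1; funext k; exact ha k
    have hlhs : Tendsto (fun k => ⟪𝒯.inclVH (d (a k)), U t⟫ - ⟪𝒯.inclVH (d (a k)), φ⟫) atTop
        (𝓝 (⟪𝒯.inclVH v, U t⟫ - ⟪𝒯.inclVH v, φ⟫)) := by
      have hι : Tendsto (fun k => 𝒯.inclVH (d (a k))) atTop (𝓝 (𝒯.inclVH v)) :=
        (𝒯.inclVH.continuous.tendsto v).comp hav
      exact (((continuous_id.inner continuous_const).tendsto _).comp hι).sub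
        (((continuous_id.inner continuous_const).tendsto _).comp hι)
    -- a bound for `‖d (a k)‖`
    obtain ⟨Md, hMd⟩ := hav.norm.bddAbove_range
    have hMd' : ∀ k, ‖d (a k)‖ ≤ Md := fun k => hMd ⟨k, rfl⟩
    have hMd0 : 0 ≤ Md := (norm_nonneg _).trans (hMd' 0)
    have hrhs : Tendsto (fun k => ∫ s in (0 : ℝ)..t, -(𝒯.pairing (d (a k)) (A s (U s)))) atTop
        (𝓝 (∫ s in (0 : ℝ)..t, -(𝒯.pairing v (A s (U s))))) := by
      refine intervalIntegral.tendsto_integral_filter_of_dominated_convergence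
        (fun _ => ‖𝒯.pairing‖ * Md * C) (Eventually.of_forall fun k => ?_)
        (Eventually.of_forall fun k => ae_of_all _ fun s hs => ?_) intervalIntegrable_const
        (ae_of_all _ fun s hs => ?_)
      · refine ((hgU (d (a k))).neg.mono ?_).aestronglyMeasurable measurableSet_uIoc
        rw [uIoc_of_le ht.1]
        exact Ioc_subset_Icc_self.trans (Icc_subset_Icc le_rfl ht.2)
      · rw [uIoc_of_le ht.1] at hs
        have hs' : s ∈ Icc 0 T := ⟨hs.1.le, hs.2.trans ht.2⟩
        rw [norm_neg]
        calc ‖𝒯.pairing (d (a k)) (A s (U s))‖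
            ≤ ‖𝒯.pairing (d (a k))‖ * ‖A s (U s)‖ := (𝒯.pairing (d (a k))).le_opNorm _
          _ ≤ (‖𝒯.pairing‖ * Md) * C :=
            mul_le_mul ((𝒯.pairing.le_opNorm _).trans
              (mul_le_mul_of_nonneg_left (hMd' k) (norm_nonneg _))) (hAU s hs') (norm_nonneg _)
              (by positivity)
      · have hB : Tendsto (fun k => 𝒯.pairing (d (a k))) atTop (𝓝 (𝒯.pairing v)) :=
          (𝒯.pairing.continuous.tendsto v).comp hav
        exact (((ContinuousLinearMap.apply ℝ ℝ (A s (U s))).continuous.tendsto _).comp hB).neg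
    exact tendsto_nhds_unique (hlhs.congr fun k => hident_d (a k) t ht) hrhs
  /- ## conclusion -/
  refine ⟨U, ⟨hU0, hUweak, fun v t ht => ?_, fun v => hgU v⟩, fun t ht => ?_⟩
  · -- fundamental theorem of calculus for `s ↦ (ι v | φ) + ∫₀ˢ -⟨v, A(τ, U τ)⟩ dτ`
    have hf : ContinuousOn (uncurry fun (s : ℝ) (_ : ℝ) => -(𝒯.pairing v (A s (U s))))
        (Icc 0 T ×ˢ (univ : Set ℝ)) :=
      (hgU v).neg.comp continuousOn_fst fun z hz => hz.1
    have hpic := ODE.hasDerivWithinAt_picard_Icc (f := fun (s : ℝ) (_ : ℝ) =>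
      -(𝒯.pairing v (A s (U s)))) (t₀ := 0) (tmin := 0) (tmax := T) (u := univ)
      ⟨le_rfl, hT.le⟩ hf (continuousOn_const (c := (0 : ℝ))) (fun _ _ => mem_univ _)
      ⟪𝒯.inclVH v, φ⟫ ht
    refine hpic.congr_of_mem (fun s hs => ?_) ht
    rw [ODE.picard_apply, 𝒯.pairing_inclHX, ← hident v s hs]
    ring
  · calc ‖U t‖ ^ 2 ≤ Real.sqrt (p t) ^ 2 := pow_le_pow_left₀ (norm_nonneg _) (hUnorm t ht) 2
      _ = p t := Real.sq_sqrt (hpnn t ht)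

end Literature.Analysis.FluidPDE
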